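import Summits.QuantumFields.YangMills.Theses.ScalingWindowSplit
import Literature.MathematicalPhysics.QuantumFieldTheory.LatticeGaugeProofs

/-!
# `GapAtCorrelationLength` (stmt-QuantumFields-18927) — negative-side support: non-abelianness is load-bearing

Support file (refuter / standing disprover, cycle 1) for crux W₁ = `ScalingWindowSplit.GapAtCorrelationLength` of
route `ScalingWindowSplit`, extracted from the work file `Cruxes/GapAtCorrelationLength/Disproof.lean` §1.  Tree
objects only; no Theses decl is asserted positively.

LOAD-BEARING ANALYSIS of the crux's only ∀-side hypothesis.  The crux with `IsCompactSimpleLieGroup G →` weakened to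
`ConnectedSpace G → Nonempty (LatticeRep G) →` (compact, connected, linear: of `IsCompactSimpleLieGroup =
IsSimpleCompactGroup ∧ Nonempty (LatticeRep ·)` exactly the non-abelian / no-normal-subgroup part is dropped; everything
else verbatim, written INLINE in the theorem's type — no definition is introduced) is FALSE:
`GapAtCorrelationLength_false_without_nonabelian` (pattern of the landed
`Theorems/HypercubicLimit/Negative/NonabelianLoadBearing.lean` for the parent crux).  Witness: the one-element gauge
group `PUnit` (connected; linear through the trivial representation on `ℂ¹`; excluded by `IsSimpleCompactGroup`, which
demands a non-commuting pair) — all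
lattice configurations coincide, Wilson's measure is a probability measure (`isProbabilityMeasure_wilsonMeasure`), so
every lattice Schwinger function is the value of its integrand at the unique configuration
(`latticeSchwinger_of_subsingleton`), the bare truncated reflected two-point function of the curvature is
`Φ(u)Φ(θu) − Φ(u)Φ(θu) = 0` at every step, and the polynomial floor `a_k^p ≤ T⁰_k(u,θu) = 0` contradicts `a_k > 0`.
So any proof of W₁ must use that `G` has two elements (in the tree: faithfulness of `r` plus a non-commuting pair give
a positive plaquette variance, cf. `Theorems/BrascampLiebVacuumSC/Negative/PlaquetteVarianceFloor.lean`).  The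
physics-grade companions named in the route text (finite `G`: freezing kills the floor; `U(1)`: the Coulomb phase
kills the gap) are NOT claimed here.

Contents: `integral_eq_apply_default`, `latticeSchwinger_of_subsingleton`,
`GapAtCorrelationLength_false_without_nonabelian`.  No `sorry`; axioms `propext`, `Classical.choice`, `Quot.sound`.
-/

noncomputable section

open scoped BigOperators Topology
open MeasureTheory Filter Set Function
open Literature.MathematicalPhysics.QuantumLattice Literature.MathematicalPhysics.AQFT
open Literature.MathematicalPhysics.QuantumFieldTheory

namespace Summit.QuantumFields.YangMills.Theorems.GapAtCorrelationLength.Negative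

/-- On a one-point probability space every real integral is evaluation at the point. [folklore] -/
theorem integral_eq_apply_default {Ω : Type*} [MeasurableSpace Ω] [Unique Ω] (μ : Measure Ω)
    [IsProbabilityMeasure μ] (f : Ω → ℝ) : ∫ x, f x ∂μ = f default :=
  integral_eq_const (Eventually.of_forall fun x => congrArg f (Subsingleton.elim x default))

/-- **At a one-element gauge group every lattice Schwinger function is the value of the integrand at the unique
configuration** (Wilson's measure is a probability measure for the continuous `r.ρ`). [folklore] -/
theorem latticeSchwinger_of_subsingleton {G : Type} [Group G] [TopologicalSpace G] [IsTopologicalGroup G]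
    [CompactSpace G] [MeasurableSpace G] [BorelSpace G] [Subsingleton G] (r : LatticeRep G)
    (S : SpeciesScheme (YMSpecies G)) (k n : ℕ) (σ : Fin n → YMSpecies G)
    (f : Fin n → SchwartzMap (EuclideanSpace ℝ (Fin 4)) ℝ) (U₀ : GaugeConfig 4 (S.side k) G) :
    latticeSchwinger r.ρ S (fun s => s.F) k n σ f =
      ∏ i, smearedLatticeField (σ i).F (Literature.Probability.LatticeModels.box 4 (S.L k)) (S.a k)
        (S.c (σ i) k) (S.m (σ i) k) (f i) (torusLift (S.side k) U₀) := by
  haveI := isProbabilityMeasure_wilsonMeasure (d := 4) (L := S.side k) r.ρ r.continuous (S.β k)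
  haveI : Unique (GaugeConfig 4 (S.side k) G) := ⟨⟨U₀⟩, fun V => Subsingleton.elim _ _⟩
  unfold latticeSchwinger
  rw [integral_eq_apply_default, Subsingleton.elim (default : GaugeConfig 4 (S.side k) G) U₀]

/-- **Non-abelianness (simplicity) is load-bearing: the crux with `IsCompactSimpleLieGroup G` weakened to
"compact, connected, linear" is FALSE** (witness `G = PUnit`, connected, with the faithful continuous unitary
representation `ρ ≡ 1` on `ℂ¹`): all configurations coincide, so the bare truncated reflected two-point function of
the curvature is `Φ(u)Φ(θu) − Φ(u)Φ(θu) = 0` at every step, and the floor `a_k^p ≤ 0` contradicts `a_k > 0`.  Any proof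
of W₁ must use that `G` has two non-commuting elements (in the tree: faithfulness of `r` + a non-commuting pair give a
positive plaquette variance). [folklore] -/
theorem GapAtCorrelationLength_false_without_nonabelian :
    ¬ (let E := EuclideanSpace ℝ (Fin 4); ∀ (G : Type) [Group G] [TopologicalSpace G] [IsTopologicalGroup G] [CompactSpace G], ConnectedSpace G → Nonempty (LatticeRep G) → letI : MeasurableSpace G := borel G; haveI : BorelSpace G := ⟨rfl⟩; ∃ (r : LatticeRep G) (sch : SpeciesScheme (YMSpecies G)) (u : SchwartzMap E ℝ) (p : ℕ) (M Δ C : ℝ), let bare : SpeciesScheme (YMSpecies G) := { sch with c := fun _ _ => 1, m := fun _ _ => 0 }; let T : SchwartzMap E ℝ → ℕ → ℝ := fun w k => latticeSchwinger r.ρ bare (fun s => s.F) k (1 + 1) (fun _ => r.curvature) ![w, thetaTest 4 w] - latticeSchwinger r.ρ bare (fun s => s.F) k 1 (fun _ => r.curvature) ![w] * latticeSchwinger r.ρ bare (fun s => s.F) k 1 (fun _ => r.curvature) ![thetaTest 4 w]; sch.HasWeakCouplingLimit ∧ (∃ N : ℕ, 1 ≤ N ∧ ∀ᶠ k in Filter.atTop,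 (sch.a k)⁻¹ ≤ (sch.a k * (sch.L k : ℝ)) ^ N) ∧ 0 < Δ ∧ HasLatticeMassGap r sch Δ ∧ (∀ᶠ k in Filter.atTop, ∀ (S₀ T₀ n : ℕ), sch.L k ≤ S₀ → 2 * (T₀ + n + 1) ≤ S₀ → ∀ (Y : LGConfig 4 G → ℝ) (B : ℝ), Measurable Y → (∀ U, |Y U| ≤ B) → DependsOn Y {e : Literature.MathematicalPhysics.QuantumLattice.ZdEdge 4 | 1 ≤ e.1 0 ∧ e.1 0 + (if e.2 = 0 then 1 else 0) ≤ T₀} → |(∫ U, Y (torusLift (2 * S₀ + 1) (GaugeConfig.timeReflect U)) * Y (configShift (-Pi.single 0 (n : ℤ)) (torusLift (2 * S₀ + 1) U)) ∂(wilsonMeasure r.ρ (sch.β k) : Measure (GaugeConfig 4 (2 * S₀ + 1) G))) - (∫ U, Y (torusLift (2 * S₀ + 1) U) ∂(wilsonMeasure r.ρ (sch.β k) : Measure (GaugeConfig 4 (2 * S₀ + 1) G))) ^ 2| ≤ Real.exp (-(Δ * sch.a k * n)) * ((∫ U, Y (torusLift (2 * S₀ + 1) (GaugeConfig.timeReflect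 U)) * Y (torusLift (2 * S₀ + 1) U) ∂(wilsonMeasure r.ρ (sch.β k) : Measure (GaugeConfig 4 (2 * S₀ + 1) G))) - (∫ U, Y (torusLift (2 * S₀ + 1) U) ∂(wilsonMeasure r.ρ (sch.β k) : Measure (GaugeConfig 4 (2 * S₀ + 1) G))) ^ 2) + C * B ^ 2 * Real.exp (-(Δ * sch.a k * S₀))) ∧ tsupport u ⊆ {y : E | y 0 < 0} ∧ ∀ᶠ k in Filter.atTop, (sch.a k) ^ p ≤ T u k ∧ T u k ≤ M * T (timeShiftTest 4 (-1) u) k) := by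
  intro h
  letI : MeasurableSpace PUnit.{1} := borel PUnit
  haveI : BorelSpace PUnit.{1} := ⟨rfl⟩
  obtain ⟨r, sch, u, p, M, Δ, C, -, -, -, -, -, -, hfw⟩ :=
    h PUnit inferInstance ⟨⟨1, 1, continuous_const, fun a b _ => Subsingleton.elim a b, fun _ => by simp⟩⟩
  obtain ⟨k, hfloor, -⟩ := hfw.exists
  -- the bare scheme and the unique configuration
  set bare : SpeciesScheme (YMSpecies PUnit.{1}) := { sch with c := fun _ _ => 1, m := fun _ _ => 0 } with hbare
  have hT : ∀ (n : ℕ) (σ : Fin n → YMSpecies PUnit.{1}) (f : Fin n → SchwartzMap (EuclideanSpace ℝ (Fin 4)) ℝ),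
      latticeSchwinger r.ρ bare (fun s => s.F) k n σ f =
        ∏ i, smearedLatticeField (σ i).F (Literature.Probability.LatticeModels.box 4 (bare.L k)) (bare.a k)
          (bare.c (σ i) k) (bare.m (σ i) k) (f i) (torusLift (bare.side k) default) :=
    fun n σ f => latticeSchwinger_of_subsingleton r bare k n σ f default
  have h2 := hT (1 + 1) (fun _ => r.curvature) ![u, thetaTest 4 u]
  have h1 := hT 1 (fun _ => r.curvature) ![u]
  have h1' := hT 1 (fun _ => r.curvature) ![thetaTest 4 u]
  rw [Fin.prod_univ_two] at h2
  rw [Fin.prod_univ_one] at h1 h1'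
  simp only [Matrix.cons_val_zero, Matrix.cons_val_one] at h2 h1 h1'
  have hzero : latticeSchwinger r.ρ bare (fun s => s.F) k (1 + 1) (fun _ => r.curvature) ![u, thetaTest 4 u] -
      latticeSchwinger r.ρ bare (fun s => s.F) k 1 (fun _ => r.curvature) ![u] *
        latticeSchwinger r.ρ bare (fun s => s.F) k 1 (fun _ => r.curvature) ![thetaTest 4 u] = 0 := by
    rw [h2, h1, h1']; ring
  have hpos : 0 < sch.a k ^ p := pow_pos (sch.a_pos k) p
  have hle : sch.a k ^ p ≤ 0 := by simpa [hbare] using hfloor.trans_eq hzero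
  exact absurd hle (not_le.2 hpos)

end Summit.QuantumFields.YangMills.Theorems.GapAtCorrelationLength.Negative

end
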